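import Literature.NumberTheory.LFunctions.MoebiusWalshTypeIIZero
import HarnessLib

/-!
# The type-II box estimate with the unshifted window (`K = 0`): closed-form evaluation of the
# core count (Bourgain 2013, §2, (2.18)–(2.22) summed)

Topic `Literature/NumberTheory/LFunctions`; proofs-only (theorems, plus three elementary `def`s
with bodies naming constants and the loss function). A companion of
`MoebiusWalshTypeIIZero.lean` (`MoebiusWalshTypeII.boxSum_sq_typeII_zero_le`, J. Bourgain,
*Möbius–Walsh correlation bounds and an estimate of Mauduit and Rivat*, J. Anal. Math. **119**
(2013) 147–163 = arXiv:1109.2784 [Bourgain2013MoebiusWalsh], §2 (2.1)–(2.22)), towards the named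
facts `bourgain_moebius_walsh_uniform`, `bourgain_liouville_walsh_uniform` and the Sieve twin
`Literature.NumberTheory.Sieve.bourgain_liouville_walsh` (Theorem 1 and its Liouville parenthesis).

`boxSum_sq_typeII_zero_le` leaves the core count of `typeII_core_zero_walsh` in closed but
unsummed form (a double sum over the lag `h < 2^ρ` and the `2`-adic level `r < q`,
`q = i + ρ + 1 + t`, with a `min` of the sup branch (2.21) and the `ℓ¹` branch (2.20)). Here that
expression is evaluated ONCE AND FOR ALL into

  `CORE ≤ 2^ρ · 2^i · 2^j · zeroLoss i ρ t η`,
  `zeroLoss i ρ t η = 100 q (q+1) (2^ρ)³ 4^t (η² + η^{2θ} + 2^{-c₀ i})`   (`typeII_core_zero_eval`),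

`η = 2·2^{-c₂|T'|}` the sup datum (Lemma 2), `c₀ = 1 - 2κ > 0` (`typeIIGap`, `κ = walshL1Exponent`)
and `θ = c₀/(1 + c₀)` (`typeIITheta`), valid for the short side `i ≤ j`. The switch between the
two branches of the `min` (Bourgain's choice of `r` at `ML2^{-r} ≈ L^C`, (2.20)/(2.21)) is made
UNIFORMLY by the inequality `min(A·2^u, B·2^{-c₀u}) ≤ A^θ B^{1-θ}` (`min_le_of_gap`), and every
geometric series is replaced by `q ·` its largest term (all savings of the paper being
`2^{-λ^{1/10}}`-type, polynomial losses in `q ≤ λ` are immaterial). Consequently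
(`boxSum_sq_typeII_zero_eval`)

  `(boxSum T i j α β)² ≤ 4 · 4^i · 4^j · (1/2^ρ + 6/2^t + 12·2^ρ/2^j + zeroLoss i ρ t η)`,

which is (2.22)/(2.29) of the paper for the bottom window: `(2.1) ≲ MN (L^{-1/2} + … + L^C η^θ + M^{-c})`.

## References

* J. Bourgain, J. Anal. Math. 119 (2013) 147–163, §2, (2.18)–(2.22), (2.28)–(2.29).
  [Bourgain2013MoebiusWalsh]
-/

noncomputable section

open Finset Real

namespace Literature.NumberTheory.LFunctions.MoebiusWalshTypeII

open Literature.NumberTheory.LFunctions.MoebiusWalshVaughan (natWalsh dyBlock mem_dyBlock boxSum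
  abs_natWalsh)
open Literature.NumberTheory.LFunctions.MoebiusWalsh (walshCoeff walshSupExponent walshL1Exponent
  walshL1Exponent_lt_half walshL1Exponent_pos)

/-! ### The constants `c₀ = 1 - 2κ` and `θ = c₀/(1+c₀)` -/

/-- The gap `c₀ = 1 - 2κ > 0` between the squared `ℓ¹` exponent of Lemma 3 and `1`
(Bourgain's "`1 - c`" in (2.19), (2.24)). [cite: Bourgain2013MoebiusWalsh, (2.19)] -/
def typeIIGap : ℝ := 1 - 2 * walshL1Exponent

/-- `0 < c₀`. [folklore] -/
theorem typeIIGap_pos : 0 < typeIIGap := by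
  unfold typeIIGap; have := walshL1Exponent_lt_half; linarith

/-- `c₀ < 1`. [folklore] -/
theorem typeIIGap_lt_one : typeIIGap < 1 := by
  unfold typeIIGap; have := walshL1Exponent_pos; linarith

/-- The interpolation exponent `θ = c₀/(1 + c₀)` of the uniform switch between (2.20) and (2.21).
[cite: Bourgain2013MoebiusWalsh, (2.20)–(2.21)] -/
def typeIITheta : ℝ := typeIIGap / (1 + typeIIGap)

/-- `0 < θ`. [folklore] -/
theorem typeIITheta_pos : 0 < typeIITheta := by
  unfold typeIITheta; have := typeIIGap_pos; positivity

/-- `θ < 1`. [folklore] -/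
theorem typeIITheta_lt_one : typeIITheta < 1 := by
  unfold typeIITheta
  have h := typeIIGap_pos
  rw [div_lt_one (by linarith)]; linarith

/-- The defining identity of `θ`: `θ - c₀ (1 - θ) = 0`. [folklore] -/
theorem typeIITheta_sub : typeIITheta - typeIIGap * (1 - typeIITheta) = 0 := by
  unfold typeIITheta
  have h := typeIIGap_pos
  field_simp
  ring

/-- `min a b ≤ a^θ b^{1-θ}` for `a, b ≥ 0`, `0 ≤ θ ≤ 1`. [folklore] -/
theorem min_le_rpow_mul_rpow {a b θ : ℝ} (ha : 0 ≤ a) (hb : 0 ≤ b) (h0 : 0 ≤ θ) (h1 : θ ≤ 1) :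
    min a b ≤ a ^ θ * b ^ (1 - θ) := by
  have hm0 : 0 ≤ min a b := le_min ha hb
  calc min a b = (min a b) ^ θ * (min a b) ^ (1 - θ) := by
        rw [← Real.rpow_add' hm0 (by linarith)]; simp
    _ ≤ a ^ θ * b ^ (1 - θ) :=
        mul_le_mul (Real.rpow_le_rpow hm0 (min_le_left _ _) h0)
          (Real.rpow_le_rpow hm0 (min_le_right _ _) (by linarith)) (Real.rpow_nonneg hm0 _)
          (Real.rpow_nonneg ha _)

/-- **The uniform switch**: `min (A X) (B X^{-c₀}) ≤ A^θ B^{1-θ}` for `A, B ≥ 0`, `X > 0`.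
[cite: Bourgain2013MoebiusWalsh, (2.20)–(2.21)] -/
theorem min_le_of_gap {A B X : ℝ} (hA : 0 ≤ A) (hB : 0 ≤ B) (hX : 0 < X) :
    min (A * X) (B * X ^ (-typeIIGap)) ≤ A ^ typeIITheta * B ^ (1 - typeIITheta) := by
  have h0 := typeIITheta_pos
  have h1 := typeIITheta_lt_one
  have hXc : 0 ≤ X ^ (-typeIIGap) := Real.rpow_nonneg hX.le _
  calc min (A * X) (B * X ^ (-typeIIGap))
      ≤ (A * X) ^ typeIITheta * (B * X ^ (-typeIIGap)) ^ (1 - typeIITheta) :=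
        min_le_rpow_mul_rpow (mul_nonneg hA hX.le) (mul_nonneg hB hXc) h0.le h1.le
    _ = A ^ typeIITheta * B ^ (1 - typeIITheta) *
          (X ^ typeIITheta * (X ^ (-typeIIGap)) ^ (1 - typeIITheta)) := by
        rw [Real.mul_rpow hA hX.le, Real.mul_rpow hB hXc]; ring
    _ = A ^ typeIITheta * B ^ (1 - typeIITheta) := by
        rw [← Real.rpow_mul hX.le, ← Real.rpow_add hX,
          show typeIITheta + -typeIIGap * (1 - typeIITheta) = 0 by
            have := typeIITheta_sub; linarith, Real.rpow_zero, mul_one]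

/-- `2^{2κ x} = 2^x · (2^x)^{-c₀}` for `x : ℝ`, written with natural powers for `x = n : ℕ`:
`(2^{κ n})² = 2^n (2^n)^{-c₀}`. [folklore] -/
theorem rpow_kappa_sq (n : ℕ) :
    ((2 : ℝ) ^ (walshL1Exponent * n)) ^ 2 = (2 : ℝ) ^ n * ((2 : ℝ) ^ n) ^ (-typeIIGap) := by
  have h2 : (0 : ℝ) < 2 := by norm_num
  rw [← Real.rpow_natCast ((2 : ℝ) ^ (walshL1Exponent * n)) 2, ← Real.rpow_mul h2.le,
    ← Real.rpow_natCast (2 : ℝ) n, ← Real.rpow_mul h2.le, ← Real.rpow_add h2]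
  congr 1
  unfold typeIIGap
  push_cast
  ring

/-- `(2^n)^{-c₀} ≤ 1`. [folklore] -/
theorem rpow_neg_gap_le_one (n : ℕ) : ((2 : ℝ) ^ n) ^ (-typeIIGap) ≤ 1 :=
  Real.rpow_le_one_of_one_le_of_nonpos (one_le_pow₀ (by norm_num)) (by have := typeIIGap_pos; linarith)

/-- `2^{2κ(i+s)} ≤ 2^i (2^i)^{-c₀} 2^s`: the square of the `ℓ¹` bound on `q = i + s` digits against
the short side `2^i`. [folklore] -/
theorem rpow_kappa_sq_le (i s : ℕ) :
    ((2 : ℝ) ^ (walshL1Exponent * ((i + s : ℕ) : ℝ))) ^ 2 ≤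
      (2 : ℝ) ^ i * ((2 : ℝ) ^ i) ^ (-typeIIGap) * 2 ^ s := by
  rw [rpow_kappa_sq, pow_add, Real.mul_rpow (by positivity) (by positivity)]
  have h1 := rpow_neg_gap_le_one s
  have h2 : 0 ≤ ((2 : ℝ) ^ i) ^ (-typeIIGap) := Real.rpow_nonneg (by positivity) _
  have h3 : (0 : ℝ) ≤ 2 ^ i * 2 ^ s * ((2 : ℝ) ^ i) ^ (-typeIIGap) := by positivity
  calc (2 : ℝ) ^ i * 2 ^ s * (((2 : ℝ) ^ i) ^ (-typeIIGap) * ((2 : ℝ) ^ s) ^ (-typeIIGap))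
      = (2 ^ i * 2 ^ s * ((2 : ℝ) ^ i) ^ (-typeIIGap)) * ((2 : ℝ) ^ s) ^ (-typeIIGap) := by ring
    _ ≤ (2 ^ i * 2 ^ s * ((2 : ℝ) ^ i) ^ (-typeIIGap)) * 1 := mul_le_mul_of_nonneg_left h1 h3
    _ = (2 : ℝ) ^ i * ((2 : ℝ) ^ i) ^ (-typeIIGap) * 2 ^ s := by ring

/-! ### The loss function of the bottom window -/

/-- The loss of the `K = 0` type-II box estimate after evaluation of the core count:
`zeroLoss i ρ t η = 100 q (q+1) (2^ρ)³ 4^t (η² + η^{2θ} + (2^i)^{-c₀})`, `q = i + ρ + 1 + t`.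
[cite: Bourgain2013MoebiusWalsh, (2.22)] -/
def zeroLoss (i ρ t : ℕ) (η : ℝ) : ℝ :=
  100 * ((i + ρ + 1 + t : ℕ) : ℝ) * ((i + ρ + 1 + t : ℕ) + 1) * ((2 : ℝ) ^ ρ) ^ 3 * 4 ^ t *
    (η ^ 2 + η ^ (2 * typeIITheta) + ((2 : ℝ) ^ i) ^ (-typeIIGap))

/-- `zeroLoss ≥ 0` for `η ≥ 0`. [folklore] -/
theorem zeroLoss_nonneg (i ρ t : ℕ) {η : ℝ} (hη : 0 ≤ η) : 0 ≤ zeroLoss i ρ t η := by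
  unfold zeroLoss
  have h1 : 0 ≤ η ^ (2 * typeIITheta) := Real.rpow_nonneg hη _
  have h2 : 0 ≤ ((2 : ℝ) ^ i) ^ (-typeIIGap) := Real.rpow_nonneg (by positivity) _
  positivity

/-! ### Evaluation of the core count -/

/-- `1 + log 2^q ≤ q + 1`. [folklore] -/
theorem one_add_log_two_pow_le (q : ℕ) : 1 + Real.log ((2 : ℝ) ^ q) ≤ q + 1 := by
  rw [Real.log_pow]
  have h2 : Real.log 2 ≤ 1 := by have := Real.log_two_lt_d9; linarith
  have : (q : ℝ) * Real.log 2 ≤ q := by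
    have := mul_le_mul_of_nonneg_left h2 (Nat.cast_nonneg q); simpa using this
  linarith

/-- `0 ≤ 1 + log 2^q`. [folklore] -/
theorem one_add_log_two_pow_nonneg (q : ℕ) : 0 ≤ 1 + Real.log ((2 : ℝ) ^ q) := by
  have := Real.log_nonneg (one_le_pow₀ (M₀ := ℝ) one_le_two (n := q)); linarith

/-- `1 ≤ 1 + log 2^q`. [folklore] -/
theorem one_le_one_add_log_two_pow (q : ℕ) : 1 ≤ 1 + Real.log ((2 : ℝ) ^ q) := by
  have := Real.log_nonneg (one_le_pow₀ (M₀ := ℝ) one_le_two (n := q)); linarith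

/-- The `2`-adic valuation of `0 < h < 2^ρ` is `< ρ`. [folklore] -/
theorem factorization_two_lt_of_mem_Ico {ρ h : ℕ} (hh : h ∈ Ico 1 (2 ^ ρ)) :
    h.factorization 2 < ρ := by
  rw [Finset.mem_Ico] at hh
  have hh0 : h ≠ 0 := by omega
  have h1 : 2 ^ h.factorization 2 ≤ h := Nat.ordProj_le 2 hh0
  exact (Nat.pow_lt_pow_iff_right (by norm_num : 1 < 2)).1 (lt_of_le_of_lt h1 hh.2)

/-- One summand of the double sum of the `K = 0` core count, for the short side `i ≤ j`, a lag
`0 < h < 2^ρ` and a level `r < q = i + ρ + 1 + t`: it is at most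
`2^i 2^j · (2^ρ2^t) (1 + log 2^q) 2^ρ (88 (2^ρ2^t) (2^i)^{-c₀} + 32 E^{2θ})`.
[cite: Bourgain2013MoebiusWalsh, §2 (2.18)–(2.21)] -/
theorem typeII_core_zero_summand_le (i j ρ t : ℕ) (hij : i ≤ j) {E : ℝ} (hE : 0 ≤ E) {h r : ℕ}
    (hh : h ∈ Ico 1 (2 ^ ρ)) (hr : r < i + ρ + 1 + t) :
    ((((2 ^ (j + 1) : ℕ) : ℝ) - (2 ^ j : ℕ)) + 2 ^ (i + ρ + 1 + t - r)) *
        ((1 + Real.log (2 ^ (i + ρ + 1 + t))) *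
            ((2 * (2 : ℝ) ^ (walshL1Exponent * ((i + ρ + 1 + t - 0 : ℕ) : ℝ))) *
              (2 * (2 : ℝ) ^ (walshL1Exponent * ((i + ρ + 1 + t - r : ℕ) : ℝ)))) +
          2 * (min (E ^ 2 * 2 ^ (i + ρ + 1 + t - (r - h.factorization 2)) * 2 ^ (i + ρ + 1 + t - r))
                  ((2 * (2 : ℝ) ^ (walshL1Exponent *
                      ((i + ρ + 1 + t - (r - h.factorization 2) : ℕ) : ℝ))) *
                    (2 * (2 : ℝ) ^ (walshL1Exponent * ((i + ρ + 1 + t - r : ℕ) : ℝ)))) *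
            (2 * ((2 : ℝ) ^ i / 2 ^ (i + ρ + 1 + t - r)) + 2 ^ (r - h.factorization 2) *
              (1 + Real.log (2 ^ (r - h.factorization 2)))))) ≤
      (2 : ℝ) ^ i * 2 ^ j * ((2 ^ ρ * 2 ^ t) * (1 + Real.log (2 ^ (i + ρ + 1 + t))) * 2 ^ ρ *
        (88 * (2 ^ ρ * 2 ^ t) * ((2 : ℝ) ^ i) ^ (-typeIIGap) + 32 * E ^ (2 * typeIITheta))) := by
  set q : ℕ := i + ρ + 1 + t with hq
  -- scalars
  have hκ0 : 0 < walshL1Exponent := walshL1Exponent_pos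
  have hκ1 : walshL1Exponent ≤ 1 := by have := walshL1Exponent_lt_half; linarith
  have hM0 : (0 : ℝ) < 2 ^ i := by positivity
  have hN0 : (0 : ℝ) < 2 ^ j := by positivity
  have hL1 : (1 : ℝ) ≤ 2 ^ ρ := one_le_pow₀ (by norm_num)
  have hL0 : (0 : ℝ) < 2 ^ ρ := by positivity
  have h2t1 : (1 : ℝ) ≤ 2 ^ t := one_le_pow₀ (by norm_num)
  have hΛ1 : (1 : ℝ) ≤ 2 ^ ρ * 2 ^ t := by nlinarith
  have hlam1 : 1 ≤ 1 + Real.log ((2 : ℝ) ^ q) := one_le_one_add_log_two_pow q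
  have hlam0 : 0 ≤ 1 + Real.log ((2 : ℝ) ^ q) := by linarith
  have hG0 : 0 ≤ ((2 : ℝ) ^ i) ^ (-typeIIGap) := Real.rpow_nonneg (by positivity) _
  have hF0 : 0 ≤ E ^ (2 * typeIITheta) := Real.rpow_nonneg hE _
  have hMN : (2 : ℝ) ^ i ≤ 2 ^ j := pow_le_pow_right₀ (by norm_num) hij
  have hNdiff : (((2 ^ (j + 1) : ℕ) : ℝ) - (2 ^ j : ℕ)) = 2 ^ j := by push_cast; ring
  have h2q : (2 : ℝ) ^ q = 2 * 2 ^ i * (2 ^ ρ * 2 ^ t) := by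
    rw [hq]; simp only [pow_add, pow_one]; ring
  -- the square of the ℓ¹ exponent on `q` digits
  have hsq : ((2 : ℝ) ^ (walshL1Exponent * ((q : ℕ) : ℝ))) ^ 2 ≤
      2 * 2 ^ i * (2 ^ ρ * 2 ^ t) * ((2 : ℝ) ^ i) ^ (-typeIIGap) := by
    have h := rpow_kappa_sq_le i (ρ + 1 + t)
    have e1 : (i + (ρ + 1 + t) : ℕ) = q := by rw [hq]; ring
    rw [e1] at h
    refine h.trans (le_of_eq ?_)
    simp only [pow_add, pow_one]; ring
  -- the levels
  have hvρ : h.factorization 2 < ρ := factorization_two_lt_of_mem_Ico hh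
  have hu1 : 1 ≤ q - r := by omega
  have her : r - h.factorization 2 ≤ r := Nat.sub_le r _
  have heq : q - (r - h.factorization 2) ≤ (q - r) + ρ := by omega
  have hX0 : (0 : ℝ) < 2 ^ (q - r) := by positivity
  have hXq : (2 : ℝ) ^ (q - r) ≤ 2 ^ q := pow_le_pow_right₀ (by norm_num) (Nat.sub_le q r)
  have hY0 : (0 : ℝ) < (2 : ℝ) ^ (walshL1Exponent * ((q - r : ℕ) : ℝ)) := Real.rpow_pos_of_pos (by norm_num) _
  have hYq : (2 : ℝ) ^ (walshL1Exponent * ((q - r : ℕ) : ℝ)) ≤ (2 : ℝ) ^ (walshL1Exponent * ((q : ℕ) : ℝ)) := by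
    refine Real.rpow_le_rpow_of_exponent_le (by norm_num) ?_
    exact mul_le_mul_of_nonneg_left (by exact_mod_cast Nat.sub_le q r) hκ0.le
  have hLκ0 : (0 : ℝ) ≤ (2 ^ ρ : ℝ) ^ walshL1Exponent := Real.rpow_nonneg hL0.le _
  have hLκ : (2 ^ ρ : ℝ) ^ walshL1Exponent ≤ 2 ^ ρ := by
    conv_rhs => rw [← Real.rpow_one ((2 : ℝ) ^ ρ)]
    exact Real.rpow_le_rpow_of_exponent_le hL1 hκ1
  -- (a) the shifted level `q - e ≤ (q - r) + ρ`
  have ha : (2 : ℝ) ^ (q - (r - h.factorization 2)) ≤ 2 ^ (q - r) * 2 ^ ρ := by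
    rw [← pow_add]; exact pow_le_pow_right₀ (by norm_num) heq
  have hb : (2 : ℝ) ^ (walshL1Exponent * ((q - (r - h.factorization 2) : ℕ) : ℝ)) ≤
      (2 : ℝ) ^ (walshL1Exponent * ((q - r : ℕ) : ℝ)) * (2 ^ ρ : ℝ) ^ walshL1Exponent := by
    rw [← Real.rpow_natCast (2 : ℝ) ρ, ← Real.rpow_mul (by norm_num), ← Real.rpow_add (by norm_num)]
    refine Real.rpow_le_rpow_of_exponent_le (by norm_num) ?_
    rw [show ((ρ : ℕ) : ℝ) * walshL1Exponent = walshL1Exponent * ρ by ring, ← mul_add]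
    refine mul_le_mul_of_nonneg_left ?_ hκ0.le
    exact_mod_cast heq
  -- (c) the `min` against `m := min (E² L X X) (4 L^κ Y Y)`
  have hmin : min (E ^ 2 * 2 ^ (q - (r - h.factorization 2)) * 2 ^ (q - r))
      ((2 * (2 : ℝ) ^ (walshL1Exponent * ((q - (r - h.factorization 2) : ℕ) : ℝ))) *
        (2 * (2 : ℝ) ^ (walshL1Exponent * ((q - r : ℕ) : ℝ)))) ≤
      min (E ^ 2 * 2 ^ ρ * 2 ^ (q - r) * 2 ^ (q - r))
        (4 * (2 ^ ρ : ℝ) ^ walshL1Exponent *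
          ((2 : ℝ) ^ (walshL1Exponent * ((q - r : ℕ) : ℝ)) * (2 : ℝ) ^ (walshL1Exponent * ((q - r : ℕ) : ℝ)))) := by
    refine min_le_min ?_ ?_
    · have hE2 : 0 ≤ E ^ 2 := sq_nonneg _
      calc E ^ 2 * 2 ^ (q - (r - h.factorization 2)) * (2 : ℝ) ^ (q - r)
          ≤ E ^ 2 * (2 ^ (q - r) * 2 ^ ρ) * 2 ^ (q - r) := by gcongr
        _ = E ^ 2 * 2 ^ ρ * 2 ^ (q - r) * 2 ^ (q - r) := by ring
    · calc 2 * (2 : ℝ) ^ (walshL1Exponent * ((q - (r - h.factorization 2) : ℕ) : ℝ)) *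
            (2 * (2 : ℝ) ^ (walshL1Exponent * ((q - r : ℕ) : ℝ)))
          ≤ 2 * ((2 : ℝ) ^ (walshL1Exponent * ((q - r : ℕ) : ℝ)) * (2 ^ ρ : ℝ) ^ walshL1Exponent) *
            (2 * (2 : ℝ) ^ (walshL1Exponent * ((q - r : ℕ) : ℝ))) := by gcongr
        _ = _ := by ring
  -- the switch: `m ≤ X · 4 L F`
  have hYY : (2 : ℝ) ^ (walshL1Exponent * ((q - r : ℕ) : ℝ)) * (2 : ℝ) ^ (walshL1Exponent * ((q - r : ℕ) : ℝ)) =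
      2 ^ (q - r) * ((2 : ℝ) ^ (q - r)) ^ (-typeIIGap) := by
    rw [← sq]; exact rpow_kappa_sq (q - r)
  have hm1 : min (E ^ 2 * 2 ^ ρ * 2 ^ (q - r) * 2 ^ (q - r))
        (4 * (2 ^ ρ : ℝ) ^ walshL1Exponent *
          ((2 : ℝ) ^ (walshL1Exponent * ((q - r : ℕ) : ℝ)) * (2 : ℝ) ^ (walshL1Exponent * ((q - r : ℕ) : ℝ)))) ≤
      2 ^ (q - r) * (4 * 2 ^ ρ * E ^ (2 * typeIITheta)) := by
    have h0 := typeIITheta_pos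
    have h1 := typeIITheta_lt_one
    have hsw := min_le_of_gap (A := E ^ 2 * 2 ^ ρ) (B := 4 * (2 ^ ρ : ℝ) ^ walshL1Exponent)
      (X := (2 : ℝ) ^ (q - r)) (by positivity) (by positivity) hX0
    have hprod : (E ^ 2 * 2 ^ ρ) ^ typeIITheta * (4 * (2 ^ ρ : ℝ) ^ walshL1Exponent) ^ (1 - typeIITheta) ≤
        4 * 2 ^ ρ * E ^ (2 * typeIITheta) := by
      rw [Real.mul_rpow (sq_nonneg _) hL0.le, Real.mul_rpow (by norm_num) hLκ0]
      have e1 : (E ^ 2) ^ typeIITheta = E ^ (2 * typeIITheta) := by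
        rw [← Real.rpow_natCast E 2, ← Real.rpow_mul hE]; norm_num
      have e2 : ((2 ^ ρ : ℝ) ^ walshL1Exponent) ^ (1 - typeIITheta) = (2 ^ ρ : ℝ) ^ (walshL1Exponent * (1 - typeIITheta)) := by
        rw [← Real.rpow_mul hL0.le]
      have e3 : ((2 : ℝ) ^ ρ) ^ typeIITheta * (2 ^ ρ : ℝ) ^ (walshL1Exponent * (1 - typeIITheta)) =
          (2 ^ ρ : ℝ) ^ (typeIITheta + walshL1Exponent * (1 - typeIITheta)) := by
        rw [← Real.rpow_add hL0]
      have hexp : typeIITheta + walshL1Exponent * (1 - typeIITheta) ≤ 1 := by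
        have := mul_le_mul_of_nonneg_right hκ1 (sub_nonneg.2 h1.le); linarith
      have hLpow : (2 ^ ρ : ℝ) ^ (typeIITheta + walshL1Exponent * (1 - typeIITheta)) ≤ 2 ^ ρ := by
        conv_rhs => rw [← Real.rpow_one ((2 : ℝ) ^ ρ)]
        exact Real.rpow_le_rpow_of_exponent_le hL1 hexp
      have h4 : (4 : ℝ) ^ (1 - typeIITheta) ≤ 4 := by
        calc (4 : ℝ) ^ (1 - typeIITheta) ≤ (4 : ℝ) ^ (1 : ℝ) :=
              Real.rpow_le_rpow_of_exponent_le (by norm_num) (by linarith only [h0])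
          _ = 4 := Real.rpow_one _
      have h40 : 0 ≤ (4 : ℝ) ^ (1 - typeIITheta) := Real.rpow_nonneg (by norm_num) _
      have hLp0 : 0 ≤ (2 ^ ρ : ℝ) ^ (typeIITheta + walshL1Exponent * (1 - typeIITheta)) := Real.rpow_nonneg hL0.le _
      rw [e1, e2]
      calc E ^ (2 * typeIITheta) * ((2 : ℝ) ^ ρ) ^ typeIITheta *
            ((4 : ℝ) ^ (1 - typeIITheta) * (2 ^ ρ : ℝ) ^ (walshL1Exponent * (1 - typeIITheta)))
          = (4 : ℝ) ^ (1 - typeIITheta) * E ^ (2 * typeIITheta) *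
              (((2 : ℝ) ^ ρ) ^ typeIITheta * (2 ^ ρ : ℝ) ^ (walshL1Exponent * (1 - typeIITheta))) := by ring
        _ = (4 : ℝ) ^ (1 - typeIITheta) * E ^ (2 * typeIITheta) *
              (2 ^ ρ : ℝ) ^ (typeIITheta + walshL1Exponent * (1 - typeIITheta)) := by rw [e3]
        _ ≤ 4 * E ^ (2 * typeIITheta) * 2 ^ ρ := by gcongr
        _ = 4 * 2 ^ ρ * E ^ (2 * typeIITheta) := by ring
    have hscale : min (E ^ 2 * 2 ^ ρ * 2 ^ (q - r) * 2 ^ (q - r))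
        (4 * (2 ^ ρ : ℝ) ^ walshL1Exponent *
          ((2 : ℝ) ^ (walshL1Exponent * ((q - r : ℕ) : ℝ)) * (2 : ℝ) ^ (walshL1Exponent * ((q - r : ℕ) : ℝ)))) =
        2 ^ (q - r) * min (E ^ 2 * 2 ^ ρ * 2 ^ (q - r))
          (4 * (2 ^ ρ : ℝ) ^ walshL1Exponent * ((2 : ℝ) ^ (q - r)) ^ (-typeIIGap)) := by
      rw [hYY, mul_min_of_nonneg _ _ hX0.le]
      congr 1 <;> ring
    rw [hscale]
    exact mul_le_mul_of_nonneg_left (hsw.trans hprod) hX0.le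
  -- `m ≤ 4 L (2 M Λ G)`
  have hm2 : min (E ^ 2 * 2 ^ ρ * 2 ^ (q - r) * 2 ^ (q - r))
        (4 * (2 ^ ρ : ℝ) ^ walshL1Exponent *
          ((2 : ℝ) ^ (walshL1Exponent * ((q - r : ℕ) : ℝ)) * (2 : ℝ) ^ (walshL1Exponent * ((q - r : ℕ) : ℝ)))) ≤
      4 * 2 ^ ρ * (2 * 2 ^ i * (2 ^ ρ * 2 ^ t) * ((2 : ℝ) ^ i) ^ (-typeIIGap)) := by
    refine (min_le_right _ _).trans ?_
    have hYY' : (2 : ℝ) ^ (walshL1Exponent * ((q - r : ℕ) : ℝ)) * (2 : ℝ) ^ (walshL1Exponent * ((q - r : ℕ) : ℝ)) ≤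
        2 * 2 ^ i * (2 ^ ρ * 2 ^ t) * ((2 : ℝ) ^ i) ^ (-typeIIGap) := by
      have h1 : (2 : ℝ) ^ (walshL1Exponent * ((q - r : ℕ) : ℝ)) * (2 : ℝ) ^ (walshL1Exponent * ((q - r : ℕ) : ℝ)) ≤
          (2 : ℝ) ^ (walshL1Exponent * ((q : ℕ) : ℝ)) * (2 : ℝ) ^ (walshL1Exponent * ((q : ℕ) : ℝ)) :=
        mul_le_mul hYq hYq hY0.le (Real.rpow_nonneg (by norm_num) _)
      have h2 : (2 : ℝ) ^ (walshL1Exponent * ((q : ℕ) : ℝ)) * (2 : ℝ) ^ (walshL1Exponent * ((q : ℕ) : ℝ)) =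
          ((2 : ℝ) ^ (walshL1Exponent * ((q : ℕ) : ℝ))) ^ 2 := by ring
      linarith [hsq]
    exact mul_le_mul (mul_le_mul_of_nonneg_left hLκ (by norm_num)) hYY' (by positivity) (by positivity)
  -- (d) the last factor `≤ (2M + 2^q lam)/X`
  have hlast : 2 * ((2 : ℝ) ^ i / 2 ^ (q - r)) + 2 ^ (r - h.factorization 2) *
      (1 + Real.log (2 ^ (r - h.factorization 2))) ≤
      (2 * 2 ^ i + 2 * 2 ^ i * (2 ^ ρ * 2 ^ t) * (1 + Real.log (2 ^ q))) / 2 ^ (q - r) := by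
    have h2e : (2 : ℝ) ^ (r - h.factorization 2) ≤ 2 ^ r := pow_le_pow_right₀ (by norm_num) her
    have hrX : (2 : ℝ) ^ r * 2 ^ (q - r) = 2 ^ q := by
      rw [← pow_add]; congr 1; omega
    have hlame : 1 + Real.log ((2 : ℝ) ^ (r - h.factorization 2)) ≤ 1 + Real.log ((2 : ℝ) ^ q) := by
      have : Real.log ((2 : ℝ) ^ (r - h.factorization 2)) ≤ Real.log ((2 : ℝ) ^ q) :=
        Real.log_le_log (by positivity) (pow_le_pow_right₀ (by norm_num) (by omega))
      linarith
    have hlame0 : 0 ≤ 1 + Real.log ((2 : ℝ) ^ (r - h.factorization 2)) := one_add_log_two_pow_nonneg _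
    rw [le_div_iff₀ hX0]
    have : (2 : ℝ) ^ (r - h.factorization 2) * (1 + Real.log (2 ^ (r - h.factorization 2))) * 2 ^ (q - r) ≤
        2 ^ q * (1 + Real.log (2 ^ q)) := by
      calc (2 : ℝ) ^ (r - h.factorization 2) * (1 + Real.log (2 ^ (r - h.factorization 2))) * 2 ^ (q - r)
          ≤ 2 ^ r * (1 + Real.log (2 ^ q)) * 2 ^ (q - r) := by gcongr
        _ = 2 ^ q * (1 + Real.log (2 ^ q)) := by rw [← hrX]; ring
    have h3 : (2 : ℝ) ^ q * (1 + Real.log (2 ^ q)) = 2 * 2 ^ i * (2 ^ ρ * 2 ^ t) * (1 + Real.log (2 ^ q)) :=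
      congrArg (· * (1 + Real.log ((2 : ℝ) ^ q))) h2q
    have e : (2 * ((2 : ℝ) ^ i / 2 ^ (q - r)) + 2 ^ (r - h.factorization 2) *
        (1 + Real.log (2 ^ (r - h.factorization 2)))) * 2 ^ (q - r) =
        2 * 2 ^ i + (2 : ℝ) ^ (r - h.factorization 2) * (1 + Real.log (2 ^ (r - h.factorization 2))) * 2 ^ (q - r) := by
      field_simp
    rw [e]
    linarith
  have hlast0 : 0 ≤ 2 * ((2 : ℝ) ^ i / 2 ^ (q - r)) + 2 ^ (r - h.factorization 2) *
      (1 + Real.log (2 ^ (r - h.factorization 2))) := by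
    have := one_add_log_two_pow_nonneg (r - h.factorization 2); positivity
  -- (f) the flat term
  have hflat : (1 + Real.log (2 ^ q)) *
      ((2 * (2 : ℝ) ^ (walshL1Exponent * ((q - 0 : ℕ) : ℝ))) * (2 * (2 : ℝ) ^ (walshL1Exponent * ((q - r : ℕ) : ℝ)))) ≤
      (1 + Real.log (2 ^ q)) * (4 * (2 * 2 ^ i * (2 ^ ρ * 2 ^ t) * ((2 : ℝ) ^ i) ^ (-typeIIGap))) := by
    rw [Nat.sub_zero]
    refine mul_le_mul_of_nonneg_left ?_ hlam0
    calc 2 * (2 : ℝ) ^ (walshL1Exponent * ((q : ℕ) : ℝ)) * (2 * (2 : ℝ) ^ (walshL1Exponent * ((q - r : ℕ) : ℝ)))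
        ≤ 2 * (2 : ℝ) ^ (walshL1Exponent * ((q : ℕ) : ℝ)) * (2 * (2 : ℝ) ^ (walshL1Exponent * ((q : ℕ) : ℝ))) := by
          gcongr
      _ = 4 * ((2 : ℝ) ^ (walshL1Exponent * ((q : ℕ) : ℝ))) ^ 2 := by ring
      _ ≤ _ := by linarith [hsq]
  -- (g) the prefactor
  have hpre1 : (((2 ^ (j + 1) : ℕ) : ℝ) - (2 ^ j : ℕ)) + 2 ^ (q - r) ≤ 2 ^ j + 2 * 2 ^ i * (2 ^ ρ * 2 ^ t) := by
    rw [hNdiff, ← h2q]; linarith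
  have hNX0 : 0 ≤ (((2 ^ (j + 1) : ℕ) : ℝ) - (2 ^ j : ℕ)) + 2 ^ (q - r) := by rw [hNdiff]; positivity
  have hmin0 : 0 ≤ min (E ^ 2 * 2 ^ ρ * 2 ^ (q - r) * 2 ^ (q - r))
      (4 * (2 ^ ρ : ℝ) ^ walshL1Exponent *
        ((2 : ℝ) ^ (walshL1Exponent * ((q - r : ℕ) : ℝ)) * (2 : ℝ) ^ (walshL1Exponent * ((q - r : ℕ) : ℝ)))) := by
    exact le_min (by positivity) (by positivity)
  have h20 : (0 : ℝ) ≤ 2 := by norm_num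
  -- ### assembly: first the monotone replacement of the three factors
  have hstep := mul_le_mul_of_nonneg_left (add_le_add hflat
    (mul_le_mul_of_nonneg_left (mul_le_mul hmin hlast hlast0 hmin0) h20)) hNX0
  refine le_trans hstep ?_
  rw [hNdiff] at hpre1 ⊢
  clear hstep hflat hlast hlast0 hmin hb ha hYY hYq hXq hsq hY0 hNX0 hLκ hLκ0
  -- ### name the atoms
  revert hM0 hN0 hL1 hL0 h2t1 hlam1 hlam0 hG0 hF0 hMN hX0 hmin0 hm1 hm2 hpre1
  generalize min (E ^ 2 * 2 ^ ρ * 2 ^ (q - r) * 2 ^ (q - r))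
      (4 * (2 ^ ρ : ℝ) ^ walshL1Exponent *
        ((2 : ℝ) ^ (walshL1Exponent * ((q - r : ℕ) : ℝ)) * (2 : ℝ) ^ (walshL1Exponent * ((q - r : ℕ) : ℝ)))) = m
  generalize (2 : ℝ) ^ (q - r) = X
  generalize ((2 : ℝ) ^ i) ^ (-typeIIGap) = G
  generalize E ^ (2 * typeIITheta) = F
  generalize 1 + Real.log ((2 : ℝ) ^ q) = lam
  generalize (2 : ℝ) ^ i = M
  generalize (2 : ℝ) ^ j = N
  generalize (2 : ℝ) ^ ρ = L
  generalize (2 : ℝ) ^ t = P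
  intro hM0 hN0 hL1 hL0 hP1 hlam1 hlam0 hG0 hF0 hMN hX0 hm1 hm2 hpre1 hmin0
  -- ### the algebra
  have hP0 : 0 ≤ P := by linarith
  have hLP1 : 1 ≤ L * P := one_le_mul_of_one_le_of_one_le hL1 hP1
  have hLP0 : 0 ≤ L * P := by linarith
  have hmX : m / X ≤ 4 * L * F := by rw [div_le_iff₀ hX0]; linarith [hm1]
  have hmX0 : 0 ≤ m / X := div_nonneg hmin0 hX0.le
  have hkey : (N + X) * (2 * (m * ((2 * M + 2 * M * (L * P) * lam) / X))) =
      2 * (2 * M + 2 * M * (L * P) * lam) * (N * (m / X) + m) := by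
    field_simp
  rw [mul_add, hkey]
  -- elementary comparisons
  have g1 : N + 2 * M * (L * P) ≤ 3 * N * (L * P) := by
    have a1 : N ≤ N * (L * P) := le_mul_of_one_le_right hN0.le hLP1
    have a2 : M * (L * P) ≤ N * (L * P) := mul_le_mul_of_nonneg_right hMN hLP0
    linarith
  have g3 : 2 * M + 2 * M * (L * P) * lam ≤ 4 * M * (L * P) * lam := by
    have a1 : M ≤ M * (L * P) := le_mul_of_one_le_right hM0.le hLP1
    have a2 : M * (L * P) ≤ M * (L * P) * lam := le_mul_of_one_le_right (mul_nonneg hM0.le hLP0) hlam1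
    linarith
  have g4 : N * (m / X) + m ≤ N * (4 * L * F) + 4 * L * (2 * M * (L * P) * G) := by
    have a1 : N * (m / X) ≤ N * (4 * L * F) := mul_le_mul_of_nonneg_left hmX hN0.le
    linarith [hm2]
  have g5 : 4 * L * (2 * M * (L * P) * G) ≤ 4 * L * (2 * N * (L * P) * G) := by
    have a1 : M * ((L * P) * G) ≤ N * ((L * P) * G) := mul_le_mul_of_nonneg_right hMN (mul_nonneg hLP0 hG0)
    nlinarith [hL0.le]
  have A0 : 0 ≤ lam * (4 * (2 * M * (L * P) * G)) :=
    mul_nonneg hlam0 (mul_nonneg (by norm_num) (mul_nonneg (mul_nonneg (mul_nonneg (by norm_num) hM0.le) hLP0) hG0))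
  have hT1 : (N + X) * (lam * (4 * (2 * M * (L * P) * G))) ≤ (3 * N * (L * P)) * (lam * (4 * (2 * M * (L * P) * G))) :=
    mul_le_mul_of_nonneg_right (hpre1.trans g1) A0
  have B0 : 0 ≤ N * (m / X) + m := add_nonneg (mul_nonneg hN0.le hmX0) hmin0
  have C0 : 0 ≤ 2 * (4 * M * (L * P) * lam) :=
    mul_nonneg (by norm_num) (mul_nonneg (mul_nonneg (mul_nonneg (by norm_num) hM0.le) hLP0) hlam0)
  have hT2 : 2 * (2 * M + 2 * M * (L * P) * lam) * (N * (m / X) + m) ≤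
      2 * (4 * M * (L * P) * lam) * (N * (4 * L * F) + 4 * L * (2 * N * (L * P) * G)) :=
    mul_le_mul (mul_le_mul_of_nonneg_left g3 (by norm_num)) (g4.trans (by linarith [g5])) B0 C0
  have hK : 0 ≤ M * N * lam * ((L * P) * (L * P)) * G :=
    mul_nonneg (mul_nonneg (mul_nonneg (mul_nonneg hM0.le hN0.le) hlam0) (mul_nonneg hLP0 hLP0)) hG0
  have hneg : 24 * (M * N * lam * ((L * P) * (L * P)) * G) * (1 - L) ≤ 0 :=
    mul_nonpos_of_nonneg_of_nonpos (by linarith) (by linarith)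
  have e : (3 * N * (L * P)) * (lam * (4 * (2 * M * (L * P) * G))) +
      2 * (4 * M * (L * P) * lam) * (N * (4 * L * F) + 4 * L * (2 * N * (L * P) * G)) =
      M * N * ((L * P) * lam * L * (88 * (L * P) * G + 32 * F)) +
        24 * (M * N * lam * ((L * P) * (L * P)) * G) * (1 - L) := by ring
  linarith [hT1, hT2, hneg, e]

set_option maxHeartbeats 400000 in
/-- **Evaluation of the `K = 0` core count.** For the short side `i ≤ j`, lags `h < 2^ρ`, levels
`r < q = i + ρ + 1 + t` and any sup datum `E ≥ 0` in place of `2·2^{-c₂|T'|}`, the diagonal term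
plus the double sum of `typeII_core_zero_walsh` (in the exact shape in which it appears in
`boxSum_sq_typeII_zero_le`, with `N = 2^{j+1} - 2^j`) is at most `2^ρ 2^i 2^j · zeroLoss i ρ t E`.
[cite: Bourgain2013MoebiusWalsh, §2 (2.18)–(2.22)] -/
theorem typeII_core_zero_eval (i j ρ t : ℕ) (hij : i ≤ j) {E : ℝ} (hE : 0 ≤ E) :
    ((2 ^ ρ : ℕ) * (((2 ^ (j + 1) : ℕ) - (2 ^ j : ℕ) : ℝ) * E ^ 2 *
        (2 * (2 ^ ρ : ℕ) * (2 : ℝ) ^ i + 2 ^ (i + ρ + 1 + t) * (1 + Real.log (2 ^ (i + ρ + 1 + t))))) +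
      ∑ h ∈ Ico 1 (2 ^ ρ), ∑ r ∈ range (i + ρ + 1 + t),
        ((((2 ^ (j + 1) : ℕ) : ℝ) - (2 ^ j : ℕ)) + 2 ^ (i + ρ + 1 + t - r)) *
        ((1 + Real.log (2 ^ (i + ρ + 1 + t))) *
            ((2 * (2 : ℝ) ^ (walshL1Exponent * ((i + ρ + 1 + t - 0 : ℕ) : ℝ))) *
              (2 * (2 : ℝ) ^ (walshL1Exponent * ((i + ρ + 1 + t - r : ℕ) : ℝ)))) +
          2 * (min (E ^ 2 * 2 ^ (i + ρ + 1 + t - (r - h.factorization 2)) * 2 ^ (i + ρ + 1 + t - r))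
                  ((2 * (2 : ℝ) ^ (walshL1Exponent *
                      ((i + ρ + 1 + t - (r - h.factorization 2) : ℕ) : ℝ))) *
                    (2 * (2 : ℝ) ^ (walshL1Exponent * ((i + ρ + 1 + t - r : ℕ) : ℝ)))) *
            (2 * ((2 : ℝ) ^ i / 2 ^ (i + ρ + 1 + t - r)) + 2 ^ (r - h.factorization 2) *
              (1 + Real.log (2 ^ (r - h.factorization 2))))))) ≤
      (2 : ℝ) ^ ρ * 2 ^ i * 2 ^ j * zeroLoss i ρ t E := by
  -- the double sum
  have hsum : ∑ h ∈ Ico 1 (2 ^ ρ), ∑ r ∈ range (i + ρ + 1 + t),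
        ((((2 ^ (j + 1) : ℕ) : ℝ) - (2 ^ j : ℕ)) + 2 ^ (i + ρ + 1 + t - r)) *
        ((1 + Real.log (2 ^ (i + ρ + 1 + t))) *
            ((2 * (2 : ℝ) ^ (walshL1Exponent * ((i + ρ + 1 + t - 0 : ℕ) : ℝ))) *
              (2 * (2 : ℝ) ^ (walshL1Exponent * ((i + ρ + 1 + t - r : ℕ) : ℝ)))) +
          2 * (min (E ^ 2 * 2 ^ (i + ρ + 1 + t - (r - h.factorization 2)) * 2 ^ (i + ρ + 1 + t - r))
                  ((2 * (2 : ℝ) ^ (walshL1Exponent *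
                      ((i + ρ + 1 + t - (r - h.factorization 2) : ℕ) : ℝ))) *
                    (2 * (2 : ℝ) ^ (walshL1Exponent * ((i + ρ + 1 + t - r : ℕ) : ℝ)))) *
            (2 * ((2 : ℝ) ^ i / 2 ^ (i + ρ + 1 + t - r)) + 2 ^ (r - h.factorization 2) *
              (1 + Real.log (2 ^ (r - h.factorization 2)))))) ≤
      (2 : ℝ) ^ ρ * (i + ρ + 1 + t : ℕ) * ((2 : ℝ) ^ i * 2 ^ j * ((2 ^ ρ * 2 ^ t) *
        (1 + Real.log (2 ^ (i + ρ + 1 + t))) * 2 ^ ρ *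
        (88 * (2 ^ ρ * 2 ^ t) * ((2 : ℝ) ^ i) ^ (-typeIIGap) + 32 * E ^ (2 * typeIITheta)))) := by
    have hW0 : 0 ≤ (2 : ℝ) ^ i * 2 ^ j * ((2 ^ ρ * 2 ^ t) *
        (1 + Real.log (2 ^ (i + ρ + 1 + t))) * 2 ^ ρ *
        (88 * (2 ^ ρ * 2 ^ t) * ((2 : ℝ) ^ i) ^ (-typeIIGap) + 32 * E ^ (2 * typeIITheta))) := by
      have h1 := one_add_log_two_pow_nonneg (i + ρ + 1 + t)
      have h2 : 0 ≤ ((2 : ℝ) ^ i) ^ (-typeIIGap) := Real.rpow_nonneg (by positivity) _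
      have h3 : 0 ≤ E ^ (2 * typeIITheta) := Real.rpow_nonneg hE _
      positivity
    calc _ ≤ ∑ _h ∈ Ico 1 (2 ^ ρ), ∑ _r ∈ range (i + ρ + 1 + t), ((2 : ℝ) ^ i * 2 ^ j * ((2 ^ ρ * 2 ^ t) *
          (1 + Real.log (2 ^ (i + ρ + 1 + t))) * 2 ^ ρ *
          (88 * (2 ^ ρ * 2 ^ t) * ((2 : ℝ) ^ i) ^ (-typeIIGap) + 32 * E ^ (2 * typeIITheta)))) :=
          Finset.sum_le_sum fun h hh => Finset.sum_le_sum fun r hr =>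
            typeII_core_zero_summand_le i j ρ t hij hE hh (Finset.mem_range.1 hr)
      _ = ((2 ^ ρ - 1 : ℕ) : ℝ) * ((i + ρ + 1 + t : ℕ) * ((2 : ℝ) ^ i * 2 ^ j * ((2 ^ ρ * 2 ^ t) *
          (1 + Real.log (2 ^ (i + ρ + 1 + t))) * 2 ^ ρ *
          (88 * (2 ^ ρ * 2 ^ t) * ((2 : ℝ) ^ i) ^ (-typeIIGap) + 32 * E ^ (2 * typeIITheta))))) := by
          rw [Finset.sum_const, Finset.sum_const, Finset.card_range, Nat.card_Ico, nsmul_eq_mul,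
            nsmul_eq_mul]
      _ ≤ (2 : ℝ) ^ ρ * ((i + ρ + 1 + t : ℕ) * ((2 : ℝ) ^ i * 2 ^ j * ((2 ^ ρ * 2 ^ t) *
          (1 + Real.log (2 ^ (i + ρ + 1 + t))) * 2 ^ ρ *
          (88 * (2 ^ ρ * 2 ^ t) * ((2 : ℝ) ^ i) ^ (-typeIIGap) + 32 * E ^ (2 * typeIITheta))))) := by
          refine mul_le_mul_of_nonneg_right ?_ (by positivity)
          have : ((2 ^ ρ - 1 : ℕ) : ℝ) ≤ ((2 ^ ρ : ℕ) : ℝ) := by exact_mod_cast Nat.sub_le _ _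
          refine this.trans (le_of_eq ?_)
          push_cast; ring
      _ = _ := by ring
  -- the diagonal term and the algebra
  have hNdiff : (((2 ^ (j + 1) : ℕ) : ℝ) - (2 ^ j : ℕ)) = 2 ^ j := by push_cast; ring
  have hLnat : ((2 ^ ρ : ℕ) : ℝ) = 2 ^ ρ := by push_cast; ring
  refine (add_le_add le_rfl hsum).trans ?_
  clear hsum
  rw [hNdiff, hLnat, zeroLoss]
  have h2q : (2 : ℝ) ^ (i + ρ + 1 + t) = 2 * 2 ^ i * (2 ^ ρ * 2 ^ t) := by
    simp only [pow_add, pow_one]; ring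
  rw [h2q]
  have hlamq : 1 + Real.log (2 * 2 ^ i * ((2 : ℝ) ^ ρ * 2 ^ t)) ≤ (i + ρ + 1 + t : ℕ) + 1 := by
    rw [← h2q]; exact one_add_log_two_pow_le _
  have hlam0 : 0 ≤ 1 + Real.log (2 * 2 ^ i * ((2 : ℝ) ^ ρ * 2 ^ t)) := by
    rw [← h2q]; exact one_add_log_two_pow_nonneg _
  -- ### name the atoms
  have h4t : (4 : ℝ) ^ t = 2 ^ t * 2 ^ t := by rw [← mul_pow]; norm_num
  rw [h4t]
  have hG0 : 0 ≤ ((2 : ℝ) ^ i) ^ (-typeIIGap) := Real.rpow_nonneg (by positivity) _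
  have hF0 : 0 ≤ E ^ (2 * typeIITheta) := Real.rpow_nonneg hE _
  have hM0 : (0 : ℝ) < 2 ^ i := by positivity
  have hN0 : (0 : ℝ) < 2 ^ j := by positivity
  have hL1 : (1 : ℝ) ≤ 2 ^ ρ := one_le_pow₀ (by norm_num)
  have hP1 : (1 : ℝ) ≤ 2 ^ t := one_le_pow₀ (by norm_num)
  have hQ1 : (1 : ℝ) ≤ ((i + ρ + 1 + t : ℕ) : ℝ) := by exact_mod_cast (show 1 ≤ i + ρ + 1 + t by omega)
  revert hlamq hlam0 hG0 hF0 hM0 hN0 hL1 hP1 hQ1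
  generalize ((2 : ℝ) ^ i) ^ (-typeIIGap) = G
  generalize E ^ (2 * typeIITheta) = F
  generalize 1 + Real.log (2 * 2 ^ i * ((2 : ℝ) ^ ρ * 2 ^ t)) = lam
  generalize (((i + ρ + 1 + t : ℕ)) : ℝ) = Q
  generalize (2 : ℝ) ^ i = M
  generalize (2 : ℝ) ^ j = N
  generalize (2 : ℝ) ^ ρ = L
  generalize (2 : ℝ) ^ t = P
  intro hlamQ hlam0 hG0 hF0 hM0 hN0 hL1 hP1 hQ1
  -- ### the algebra
  have hQ0 : 0 ≤ Q := by linarith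
  have hL0 : 0 < L := by linarith
  have hP0 : 0 ≤ P := by linarith
  have hE2 : 0 ≤ E ^ 2 := sq_nonneg _
  have hLP1 : 1 ≤ L * P := one_le_mul_of_one_le_of_one_le hL1 hP1
  have hLP0 : 0 ≤ L * P := by linarith
  have hL2 : 1 ≤ L ^ 2 := one_le_pow₀ hL1
  have hPP : 1 ≤ P * P := one_le_mul_of_one_le_of_one_le hP1 hP1
  have hL2PP : 1 ≤ L ^ 2 * (P * P) := one_le_mul_of_one_le_of_one_le hL2 hPP
  have hQQ : 1 ≤ Q * (Q + 1) := by nlinarith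
  have hB0 : 0 ≤ Q * (Q + 1) * L ^ 3 * (P * P) :=
    mul_nonneg (mul_nonneg (by linarith) (pow_nonneg hL0.le 3)) (mul_nonneg hP0 hP0)
  -- `B := Q (Q+1) L³ P²` dominates the elementary losses
  have hB1 : L ≤ Q * (Q + 1) * L ^ 3 * (P * P) := by
    have h1 : L ≤ L * (L ^ 2 * (P * P)) := le_mul_of_one_le_right hL0.le hL2PP
    have h2 : L * (L ^ 2 * (P * P)) ≤ (Q * (Q + 1)) * (L * (L ^ 2 * (P * P))) :=
      le_mul_of_one_le_left (mul_nonneg hL0.le (by linarith)) hQQ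
    calc L ≤ (Q * (Q + 1)) * (L * (L ^ 2 * (P * P))) := h1.trans h2
      _ = Q * (Q + 1) * L ^ 3 * (P * P) := by ring
  have hB2 : L * P * lam ≤ Q * (Q + 1) * L ^ 3 * (P * P) := by
    have h1 : L * P * lam ≤ L * P * (Q + 1) := mul_le_mul_of_nonneg_left hlamQ hLP0
    have h3 : (1 : ℝ) ≤ Q * L ^ 2 * P := by
      calc (1 : ℝ) = 1 * 1 * 1 := by ring
        _ ≤ Q * L ^ 2 * P := mul_le_mul (mul_le_mul hQ1 hL2 zero_le_one hQ0) hP1 zero_le_one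
            (mul_nonneg hQ0 (by linarith))
    have h2 : L * P * (Q + 1) ≤ L * P * (Q + 1) * (Q * L ^ 2 * P) :=
      le_mul_of_one_le_right (mul_nonneg hLP0 (by linarith)) h3
    calc L * P * lam ≤ L * P * (Q + 1) * (Q * L ^ 2 * P) := h1.trans h2
      _ = Q * (Q + 1) * L ^ 3 * (P * P) := by ring
  have hFLP : F ≤ L * P * F := le_mul_of_one_le_left hF0 hLP1
  -- the two terms
  have t1 : N * E ^ 2 * (2 * L * M + 2 * M * (L * P) * lam) ≤
      M * N * E ^ 2 * (4 * (Q * (Q + 1) * L ^ 3 * (P * P))) := by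
    have h : 2 * L + 2 * (L * P) * lam ≤ 4 * (Q * (Q + 1) * L ^ 3 * (P * P)) := by nlinarith [hB1, hB2]
    have hMNE : 0 ≤ M * N * E ^ 2 := mul_nonneg (mul_nonneg hM0.le hN0.le) hE2
    calc N * E ^ 2 * (2 * L * M + 2 * M * (L * P) * lam) = (M * N * E ^ 2) * (2 * L + 2 * (L * P) * lam) := by ring
      _ ≤ (M * N * E ^ 2) * (4 * (Q * (Q + 1) * L ^ 3 * (P * P))) := mul_le_mul_of_nonneg_left h hMNE
      _ = _ := by ring
  have t2 : Q * (M * N * (L * P * lam * L * (88 * (L * P) * G + 32 * F))) ≤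
      M * N * (Q * (Q + 1) * L ^ 3 * (P * P) * (88 * G + 32 * F)) := by
    have ha : L * P * lam * L ≤ L * P * (Q + 1) * L :=
      mul_le_mul_of_nonneg_right (mul_le_mul_of_nonneg_left hlamQ hLP0) hL0.le
    have hb : 88 * (L * P) * G + 32 * F ≤ (L * P) * (88 * G + 32 * F) := by nlinarith [hFLP]
    have hb0 : 0 ≤ 88 * (L * P) * G + 32 * F := by nlinarith [hLP0, hG0, hF0]
    have h : L * P * lam * L * (88 * (L * P) * G + 32 * F) ≤ (L * P * (Q + 1) * L) * ((L * P) * (88 * G + 32 * F)) :=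
      mul_le_mul ha hb hb0 (mul_nonneg (mul_nonneg hLP0 (by linarith)) hL0.le)
    have hQMN : 0 ≤ Q * (M * N) := mul_nonneg hQ0 (mul_nonneg hM0.le hN0.le)
    calc Q * (M * N * (L * P * lam * L * (88 * (L * P) * G + 32 * F)))
        = (Q * (M * N)) * (L * P * lam * L * (88 * (L * P) * G + 32 * F)) := by ring
      _ ≤ (Q * (M * N)) * ((L * P * (Q + 1) * L) * ((L * P) * (88 * G + 32 * F))) :=
          mul_le_mul_of_nonneg_left h hQMN
      _ = M * N * (Q * (Q + 1) * L ^ 3 * (P * P) * (88 * G + 32 * F)) := by ring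
  have k1 := mul_le_mul_of_nonneg_left t1 hL0.le
  have k2 := mul_le_mul_of_nonneg_left t2 hL0.le
  have k3 : 4 * E ^ 2 + (88 * G + 32 * F) ≤ 100 * (E ^ 2 + F + G) := by nlinarith
  have hW : 0 ≤ L * (M * N) * (Q * (Q + 1) * L ^ 3 * (P * P)) :=
    mul_nonneg (mul_nonneg hL0.le (mul_nonneg hM0.le hN0.le)) hB0
  have k4 := mul_le_mul_of_nonneg_left k3 hW
  have e1 : L * (M * N * E ^ 2 * (4 * (Q * (Q + 1) * L ^ 3 * (P * P)))) +
      L * (M * N * (Q * (Q + 1) * L ^ 3 * (P * P) * (88 * G + 32 * F))) =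
      L * (M * N) * (Q * (Q + 1) * L ^ 3 * (P * P)) * (4 * E ^ 2 + (88 * G + 32 * F)) := by ring
  have e2 : L * (M * N) * (Q * (Q + 1) * L ^ 3 * (P * P)) * (100 * (E ^ 2 + F + G)) =
      L * M * N * (100 * Q * (Q + 1) * L ^ 3 * (P * P) * (E ^ 2 + F + G)) := by ring
  have e3 : L * Q * (M * N * (L * P * lam * L * (88 * (L * P) * G + 32 * F))) =
      L * (Q * (M * N * (L * P * lam * L * (88 * (L * P) * G + 32 * F)))) := by ring
  linarith [k1, k2, k4, e1, e2, e3]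

/-! ### The evaluated `K = 0` box estimate -/

/-- The window weight enters only through the cardinality of `T ∩ [0, q)`. [folklore] -/
theorem card_attachFin_filter_window (T : Finset ℕ) (q : ℕ) :
    ((T.filter fun x => 0 ≤ x ∧ x < q).attachFin (lt_of_mem_filter_window T q)).card =
      (T.filter fun x => x < q).card := by
  rw [Finset.card_attachFin]
  congr 1
  ext x
  simp only [Finset.mem_filter, zero_le, true_and]

set_option maxHeartbeats 400000 in
/-- **Type-II box estimate, unshifted window, evaluated** (Bourgain 2013, §2 (2.22)/(2.29) for
`K = 0`): for the short side `i ≤ j`, lags `2^ρ ≤ 2^j`, truncation depth `t`, `|α|, |β| ≤ 1` and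
`s = |T ∩ [0, i + ρ + 1 + t)|`,
`(boxSum T i j α β)² ≤ 4·4^i·4^j·(2^{-ρ} + 6·2^{-t} + 12·2^ρ/2^j + zeroLoss i ρ t (2·2^{-c₂ s}))`.
[cite: Bourgain2013MoebiusWalsh, §2 (2.22), (2.29)] -/
theorem boxSum_sq_typeII_zero_eval (T : Finset ℕ) {i j ρ : ℕ} (t : ℕ) (hij : i ≤ j) (hρj : ρ ≤ j)
    (α β : ℕ → ℝ) (hα : ∀ a, |α a| ≤ 1) (hβ : ∀ b, |β b| ≤ 1) :
    (boxSum T i j α β) ^ 2 ≤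
      4 * (4 : ℝ) ^ i * 4 ^ j * (1 / 2 ^ ρ + 6 / 2 ^ t + 12 * 2 ^ ρ / 2 ^ j +
        zeroLoss i ρ t (2 * (2 : ℝ) ^ (-(walshSupExponent * ((T.filter fun x => x < i + ρ + 1 + t).card : ℝ))))) := by
  have h := boxSum_sq_typeII_zero_le T (i := i) t hρj α β hα hβ
  rw [card_attachFin_filter_window T (i + ρ + 1 + t)] at h
  set E : ℝ := 2 * (2 : ℝ) ^ (-(walshSupExponent * ((T.filter fun x => x < i + ρ + 1 + t).card : ℝ))) with hE
  have hE0 : 0 ≤ E := by rw [hE]; positivity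
  have hcore := typeII_core_zero_eval i j ρ t hij hE0
  refine h.trans ?_
  have hZ0 : 0 ≤ zeroLoss i ρ t E := zeroLoss_nonneg i ρ t hE0
  -- replace the core by its evaluation
  have hstep : (2 : ℝ) ^ i * (4 * 2 ^ j / 2 ^ ρ) *
      ((2 : ℝ) ^ i * 2 ^ j +
        2 * 2 ^ ρ * (2 ^ i * ((2 ^ j / 2 ^ (ρ + t) + 2) * (2 ^ (ρ + 1) + 1))) +
        ((2 ^ ρ : ℕ) * (((2 ^ (j + 1) : ℕ) - (2 ^ j : ℕ) : ℝ) * E ^ 2 *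
            (2 * (2 ^ ρ : ℕ) * (2 : ℝ) ^ i + 2 ^ (i + ρ + 1 + t) * (1 + Real.log (2 ^ (i + ρ + 1 + t))))) +
          ∑ h ∈ Ico 1 (2 ^ ρ), ∑ r ∈ range (i + ρ + 1 + t),
            ((((2 ^ (j + 1) : ℕ) : ℝ) - (2 ^ j : ℕ)) + 2 ^ (i + ρ + 1 + t - r)) *
            ((1 + Real.log (2 ^ (i + ρ + 1 + t))) *
                ((2 * (2 : ℝ) ^ (walshL1Exponent * ((i + ρ + 1 + t - 0 : ℕ) : ℝ))) *
                  (2 * (2 : ℝ) ^ (walshL1Exponent * ((i + ρ + 1 + t - r : ℕ) : ℝ)))) +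
              2 * (min (E ^ 2 * 2 ^ (i + ρ + 1 + t - (r - h.factorization 2)) * 2 ^ (i + ρ + 1 + t - r))
                      ((2 * (2 : ℝ) ^ (walshL1Exponent *
                          ((i + ρ + 1 + t - (r - h.factorization 2) : ℕ) : ℝ))) *
                        (2 * (2 : ℝ) ^ (walshL1Exponent * ((i + ρ + 1 + t - r : ℕ) : ℝ)))) *
                (2 * ((2 : ℝ) ^ i / 2 ^ (i + ρ + 1 + t - r)) + 2 ^ (r - h.factorization 2) *
                  (1 + Real.log (2 ^ (r - h.factorization 2)))))))) ≤
      (2 : ℝ) ^ i * (4 * 2 ^ j / 2 ^ ρ) *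
      ((2 : ℝ) ^ i * 2 ^ j +
        2 * 2 ^ ρ * (2 ^ i * ((2 ^ j / 2 ^ (ρ + t) + 2) * (2 ^ (ρ + 1) + 1))) +
        (2 : ℝ) ^ ρ * 2 ^ i * 2 ^ j * zeroLoss i ρ t E) := by
    refine mul_le_mul_of_nonneg_left (add_le_add le_rfl hcore) (by positivity)
  refine hstep.trans ?_
  clear h hstep hcore
  -- the algebra: `(2L+1) ≤ 3L` turns the carry error into `6·2^{-t} + 12·2^ρ/2^j` exactly
  rw [pow_add, pow_succ]
  have hL1 : (1 : ℝ) ≤ 2 ^ ρ := one_le_pow₀ (by norm_num)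
  have h4i : (4 : ℝ) ^ i = 2 ^ i * 2 ^ i := by rw [← mul_pow]; norm_num
  have h4j : (4 : ℝ) ^ j = 2 ^ j * 2 ^ j := by rw [← mul_pow]; norm_num
  rw [h4i, h4j]
  have h3L : (2 : ℝ) ^ ρ * 2 + 1 ≤ 3 * 2 ^ ρ := by linarith
  calc (2 : ℝ) ^ i * (4 * 2 ^ j / 2 ^ ρ) *
        ((2 : ℝ) ^ i * 2 ^ j + 2 * 2 ^ ρ * (2 ^ i * ((2 ^ j / (2 ^ ρ * 2 ^ t) + 2) * (2 ^ ρ * 2 + 1))) +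
          (2 : ℝ) ^ ρ * 2 ^ i * 2 ^ j * zeroLoss i ρ t E)
      ≤ (2 : ℝ) ^ i * (4 * 2 ^ j / 2 ^ ρ) *
        ((2 : ℝ) ^ i * 2 ^ j + 2 * 2 ^ ρ * (2 ^ i * ((2 ^ j / (2 ^ ρ * 2 ^ t) + 2) * (3 * 2 ^ ρ))) +
          (2 : ℝ) ^ ρ * 2 ^ i * 2 ^ j * zeroLoss i ρ t E) := by
        gcongr
    _ = 4 * ((2 : ℝ) ^ i * 2 ^ i) * (2 ^ j * 2 ^ j) * (1 / 2 ^ ρ + 6 / 2 ^ t + 12 * 2 ^ ρ / 2 ^ j +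
          zeroLoss i ρ t E) := by
        field_simp
        ring

end Literature.NumberTheory.LFunctions.MoebiusWalshTypeII
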